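import Mathlib
import Summits.ValiantsHypothesis.ValiantsHypothesis.Theses.ValuativeGCT
import Literature.Computability.Complexity.OccurrenceObstructionsIPProofs
import Summits.ValiantsHypothesis.ValiantsHypothesis.Theorems.ValuativeGCTValuativeFlipIsotypicBinomialBound

/-!
# Isotypic slice bound, binomial form, part 4: the one-line reading `K_m(λ*) ≤ (m²)^(|λ| − λ₁)`

Det side of crux `ValuativeGCT.ValuativeFlip` (stmt-ValiantsHypothesis-12624; wall-breaker axis
"det-orbit-closure multiplicity bounds for detCensus").  The binomial census of part 2,
`C(λ₂ + m, m) · ∏_{i ≥ 3} C(λ_i + m² - 1, m² - 1)`, is bounded by the other side of stars and bars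
(`C(k + n, n) ≤ (n + 1)^k`, `choose_add_le_pow_base`) slot by slot: `C(λ₂ + m, m) ≤ (m+1)^(λ₂)`,
`C(λ_i + m² - 1, m² - 1) ≤ (m²)^(λ_i)`.  Since the parts from the second on sum to `|λ| - λ₁`, the
whole det census collapses to ONE power of `m²`:

* `isotypicBinomialBound_le_pow` — `C(λ₂+m, m) · ∏_{i≥3} C(λ_i+m²-1, m²-1) ≤ (m²)^(|λ| - λ₁)`
  (`m ≥ 2`, `λ` with at most `m²` parts);
* `isotypic_truncT_finrank_le_pow`, `isotypic_detOrbitMultiplicity_le_pow` — for `λ ⊢ mδ`: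
  `dim T_U(λ), K_m(λ*) ≤ (m²)^(mδ - λ₁)`;
* `isotypic_detOrbitMultiplicity_rowLift_le_pow` — in inner terms on a Kadish–Landsberg lift
  `μ♯ = rowLift μ j` (`m = n + j`): `K_m((μ♯)*) ≤ (m²)^(nδ - μ₁)` — the exponent is the weight of the
  INNER shape below its first row, independent of the padding;
* `valuativeFlip_of_powCertificates` — the crux from per-side certificates of size
  `> (m²)^(mδ - λ₁)`.

Reading for the crux.  The det side of a flip at `(n, m)` on `λ ⊢ mδ` is at most `m^(2(mδ - λ₁))`:
polynomial in `m` of degree twice the weight BELOW THE FIRST ROW — the only part of the shape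
Kadish–Landsberg leaves to the per side (`λ₁ ≥ δ(m-n)`, so `mδ - λ₁ ≤ nδ` and `K_m(λ*) ≤ m^(2nδ)` on
every per-admissible shape).  Pure arithmetic over part 2.
-/

set_option linter.dupNamespace false

namespace Summit.ValiantsHypothesis.ValiantsHypothesis.Theorems.ValuativeFlip

open MvPolynomial
open scoped BigOperators Matrix
open Literature.NumberTheory.DiophantineGeometry
open Literature.Computability.AlgebraicComplexity
open Literature.Computability.Complexity

noncomputable section

/-- Stars and bars against the other box: `C(k + n, n) ≤ (n + 1)^k` (a degree-`k` monomial in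
`n + 1` variables is a word of length `k`). [folklore] -/
theorem choose_add_le_pow_base (k n : ℕ) : (k + n).choose n ≤ (n + 1) ^ k := by
  have h := choose_add_le_succ_pow n k
  rwa [add_comm n k, Nat.choose_symm_add] at h

/-- The parts of a partition of `N` from the second on sum to `N - λ₁` (indices below any bound
`L ≥ 2` on the number of parts). [folklore] -/
theorem getD_one_add_sum_Ico_two_eq {N L : ℕ} (lam : Nat.Partition N) (hcard : lam.parts.card ≤ L)
    (hL : 2 ≤ L) :
    lam.sortedParts.getD 1 0 + ∑ i ∈ Finset.Ico 2 L, lam.sortedParts.getD i 0 =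
      N - lam.sortedParts.getD 0 0 := by
  have h := sum_range_getD_sortedParts_of_le lam hcard
  rw [Finset.range_eq_Ico, Finset.sum_eq_sum_Ico_succ_bot (by omega),
    Finset.sum_eq_sum_Ico_succ_bot (by omega)] at h
  simp only [Nat.zero_add, Nat.reduceAdd] at h
  omega

/-- **The binomial census is a single power of `m²`.**  For `m ≥ 2` and a partition `λ` of `N` with
at most `m²` parts,
`C(λ₂ + m, m) · ∏_{i ≥ 3} C(λ_i + m² - 1, m² - 1) ≤ (m²)^(N - λ₁)`:
slot by slot `C(λ₂ + m, m) ≤ (m+1)^(λ₂) ≤ (m²)^(λ₂)` and `C(λ_i + m² - 1, m² - 1) ≤ (m²)^(λ_i)`, and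
`λ₂ + λ₃ + ⋯ = N - λ₁`. [folklore; this crux's det census] -/
theorem isotypicBinomialBound_le_pow (m : ℕ) (hm : 2 ≤ m) {N : ℕ} (lam : Nat.Partition N)
    (hcard : lam.parts.card ≤ m * m) :
    (lam.sortedParts.getD 1 0 + m).choose m *
        ∏ i ∈ Finset.Ico 2 (m * m), (lam.sortedParts.getD i 0 + (m * m - 1)).choose (m * m - 1) ≤
      (m * m) ^ (N - lam.sortedParts.getD 0 0) := by
  have hmm : m + 1 ≤ m * m := by nlinarith
  have h1 : (lam.sortedParts.getD 1 0 + m).choose m ≤ (m * m) ^ lam.sortedParts.getD 1 0 :=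
    (choose_add_le_pow_base _ m).trans (Nat.pow_le_pow_left hmm _)
  have h2 : ∀ i, (lam.sortedParts.getD i 0 + (m * m - 1)).choose (m * m - 1) ≤
      (m * m) ^ lam.sortedParts.getD i 0 := fun i => by
    have h := choose_add_le_pow_base (lam.sortedParts.getD i 0) (m * m - 1)
    rwa [Nat.sub_add_cancel (by omega : 1 ≤ m * m)] at h
  calc (lam.sortedParts.getD 1 0 + m).choose m *
        ∏ i ∈ Finset.Ico 2 (m * m), (lam.sortedParts.getD i 0 + (m * m - 1)).choose (m * m - 1)
      ≤ (m * m) ^ lam.sortedParts.getD 1 0 *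
          ∏ i ∈ Finset.Ico 2 (m * m), (m * m) ^ lam.sortedParts.getD i 0 :=
        Nat.mul_le_mul h1 (Finset.prod_le_prod' fun i _ => h2 i)
    _ = (m * m) ^ (lam.sortedParts.getD 1 0 + ∑ i ∈ Finset.Ico 2 (m * m), lam.sortedParts.getD i 0) := by
        rw [Finset.prod_pow_eq_pow_sum, pow_add]
    _ = (m * m) ^ (N - lam.sortedParts.getD 0 0) := by
        rw [getD_one_add_sum_Ico_two_eq lam hcard (by omega)]

/-- **Power bound for every valuative truncation.**  For `m ≥ 2`, every centre `U`, rank bound `r`,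
degree `δ` and `λ ⊢ mδ` with at most `m²` parts, the crux's truncation (verbatim `let T` of
`ValuativeGCT.ValuativeFlip`) satisfies `dim T_U(λ) ≤ (m²)^(mδ - λ₁)`. [this crux's det census] -/
theorem isotypic_truncT_finrank_le_pow (m : ℕ) (hm : 2 ≤ m) (U : Submodule ℂ (MatIdx m → ℂ))
    (r δ : ℕ) (lam : Nat.Partition (m * δ)) (hcard : lam.parts.card ≤ m * m) :
    Module.finrank ℂ ↥(MvPolynomial.homogeneousSubmodule (MatIdx m × MatIdx m) ℂ (m * δ) ⊓
        ((MvPolynomial.vanishingIdeal ℂ {p : MatIdx m × MatIdx m → ℂ | ∀ j : MatIdx m, (fun i => p (j, i)) ∈ U}) ^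
            (δ * (m - r))).restrictScalars ℂ ⊓
        (⨅ (M : Matrix (MatIdx m) (MatIdx m) ℂ) (_ : linSubst (MatIdx m) ℂ M (detFormLex ℂ m) = detFormLex ℂ m),
          LinearMap.ker ((MvPolynomial.aeval (R := ℂ) fun p : MatIdx m × MatIdx m =>
              ∑ l : MatIdx m, M l p.2 • MvPolynomial.X (p.1, l)).toLinearMap -
            LinearMap.id (R := ℂ) (M := MvPolynomial (MatIdx m × MatIdx m) ℂ))) ⊓
        (⨅ (g : Matrix.GeneralLinearGroup (MatIdx m) ℂ) (_ : IsUpperTriangular g),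
          LinearMap.ker ((MvPolynomial.aeval (R := ℂ) fun p : MatIdx m × MatIdx m =>
              ∑ l : MatIdx m, ((g⁻¹ : Matrix.GeneralLinearGroup (MatIdx m) ℂ) : Matrix (MatIdx m) (MatIdx m) ℂ) p.1 l •
                MvPolynomial.X (l, p.2)).toLinearMap -
            weightChar ((Weight.dualOfPartition (m * m) lam).toMatIdx : Weight (MatIdx m)) g •
              LinearMap.id (R := ℂ) (M := MvPolynomial (MatIdx m × MatIdx m) ℂ)))) ≤
      (m * m) ^ (m * δ - lam.sortedParts.getD 0 0) :=
  (isotypic_truncT_finrank_le_choose m hm U r δ lam).trans (isotypicBinomialBound_le_pow m hm lam hcard)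

/-- **Power bound for the det-orbit-closure multiplicity.**  For `m ≥ 2`, `δ`, and `λ ⊢ mδ` with at
most `m²` parts, `K_m(λ*) = mult_{λ*} ℂ[Δ(det_m)] ≤ (m²)^(mδ - λ₁)`: the det side of a flip is
polynomial in `m` of degree twice the weight of the shape below its first row.  On
Kadish–Landsberg shapes (`λ₁ ≥ δ(m-n)`) this is `≤ m^(2nδ)`. [this crux's det census; BLMW 2011 §5.2] -/
theorem isotypic_detOrbitMultiplicity_le_pow : ∀ (m : ℕ) [NeZero m], 2 ≤ m → ∀ (δ : ℕ) (lam : Nat.Partition (m * δ)), lam.parts.card ≤ m * m → orbitMultiplicity ℂ (detFormLex ℂ m) m ((Weight.dualOfPartition (m * m) lam).toMatIdx : Weight (MatIdx m)) ≤ (m * m) ^ (m * δ - lam.sortedParts.getD 0 0) := by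
  intro m _ hm δ lam hlam
  exact (isotypic_detOrbitMultiplicity_le_choose m hm δ lam hlam).trans
    (isotypicBinomialBound_le_pow m hm lam hlam)

/-- The weight of a Kadish–Landsberg lift below its first row is that of the inner shape:
`(n+j)δ - (μ♯)₁ = nδ - μ₁`. [folklore] -/
theorem rowLift_size_sub_top (n j δ : ℕ) (μ : Nat.Partition (n * δ)) :
    (n + j) * δ - (rowLift μ j).sortedParts.getD 0 0 = n * δ - μ.sortedParts.getD 0 0 := by
  rw [getD_sortedParts_rowLift, if_pos rfl, add_mul]
  omega

/-- **Power bound at a lifted shape, in inner terms.**  For `m = n + j ≥ 2` and `μ ⊢ nδ` with at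
most `n²` parts, `K_m((μ♯)*) ≤ (m²)^(nδ - μ₁)`: the det side an inner certificate transported to the
padding `j` (`stub_twistedInheritance`) has to beat grows only polynomially in the padded size,
with exponent `2(nδ - μ₁)` fixed by the inner shape. [this crux's det census] -/
theorem isotypic_detOrbitMultiplicity_rowLift_le_pow (n j : ℕ) [NeZero (n + j)] (hm : 2 ≤ n + j)
    (δ : ℕ) (μ : Nat.Partition (n * δ)) (hμ : μ.parts.card ≤ n * n) :
    orbitMultiplicity ℂ (detFormLex ℂ (n + j)) (n + j) (partitionWeightLex (n + j) (rowLift μ j)) ≤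
      ((n + j) * (n + j)) ^ (n * δ - μ.sortedParts.getD 0 0) := by
  have hcard : (rowLift μ j).parts.card ≤ (n + j) * (n + j) := by
    refine (card_parts_rowLift_le μ j).trans (max_le (hμ.trans (Nat.mul_le_mul (by omega) (by omega))) ?_)
    nlinarith
  rw [← rowLift_size_sub_top n j δ μ]
  exact isotypic_detOrbitMultiplicity_le_pow (n + j) hm δ (rowLift μ j) hcard

/-- **`ValuativeFlip` from power certificates.**  The crux follows (with `U = ⊥`, `r = 0`) from:
for every `c`, eventually in `n`, at every window position `n ≤ m ≤ 2^((log₂ n + c)^c)` some shape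
`λ ⊢ mδ` (`≤ m²` parts) has `mult_{λ*} ℂ[Δ_m(X₀₀^{m-n} per_n)] > (m²)^(mδ - λ₁)`.
[this crux; reduction] -/
theorem valuativeFlip_of_powCertificates
    (h : ∀ c : ℕ, ∃ n₀ : ℕ, ∀ n ≥ n₀, ∀ (m : ℕ) [NeZero m], n ≤ m → m ≤ 2 ^ ((Nat.log 2 n + c) ^ c) →
      ∃ (δ : ℕ) (lam : Nat.Partition (m * δ)), lam.parts.card ≤ m * m ∧
        (m * m) ^ (m * δ - lam.sortedParts.getD 0 0) <
          orbitMultiplicity ℂ (paddedPerFormLex ℂ n m) m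
            ((Weight.dualOfPartition (m * m) lam).toMatIdx : Weight (MatIdx m))) :
    Summit.ValiantsHypothesis.ValiantsHypothesis.Theses.ValuativeGCT.ValuativeFlip := by
  refine valuativeFlip_of_binomialCertificates fun c => ?_
  obtain ⟨n₀, hn₀⟩ := h c
  refine ⟨max n₀ 2, fun n hn m _ hnm hm => ?_⟩
  have hm2 : 2 ≤ m := le_trans (le_of_max_le_right hn) hnm
  obtain ⟨δ, lam, hcard, hlt⟩ := hn₀ n (le_of_max_le_left hn) m hnm hm
  exact ⟨δ, lam, hcard, lt_of_le_of_lt (isotypicBinomialBound_le_pow m hm2 lam hcard) hlt⟩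

end

end Summit.ValiantsHypothesis.ValiantsHypothesis.Theorems.ValuativeFlip
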